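import Literature.NumberTheory.EllipticCurves.FormalGroupLawAxiomsProofs
import Literature.NumberTheory.EllipticCurves.CanonicalPAdicHeightThetaProofs
import HarnessLib

/-!
# The addition formula for `x` on the formal group, I: the identity at points and the evaluation
# of its two pole-cleared sides (Blakestad–Grant 2023, Lemma 10 — proofs only)

Trunk T-NT-EC (Literature/NumberTheory/EllipticCurves). Pure proof file on the way to the formal
Mazur–Tate theta relation (named fact `WeierstrassCurve.padicSigma_theta_formal`,
`CanonicalPAdicHeightThetaProofs.lean`). Blakestad–Grant's proof of Prop. 14 uses their Lemma 10,
`D(D(x - x(u))/(x - x(u))) = 2x - (τ_u^* x + τ_{-u}^* x)`, "whose proof follows readily from the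
group law on `E/K`". Its group-law content is the classical addition formula
`x(P + Q) + x(P - Q) = (Y(P)² + Y(Q)²)/(2(x(P) - x(Q))²) - b₂/2 - 2(x(P) + x(Q))`,
`Y = 2y + a₁x + a₃` (from `x(P ± Q) = λ±² + a₁λ± - a₂ - x(P) - x(Q)` with
`λ± + a₁/2 = (Y(P) ∓ Y(Q))/(2(x(P) - x(Q)))`; no use of the Weierstrass equation). This file
proves it at points (`two_mul_sq_mul_addX_add_addX`, for Mathlib's `addX`, `slope`, `negY` over
any field) and prepares its formal version in `ℚ_p⟦u, v⟧` (`FormalGroupLawAddXProofs.lean`):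
with `X = z²x(z) = formalXMulSq`, `Ỹ = (a₁z - 2)X + a₃z³` (`= z³(2y + a₁x + a₃)`),
`Δ = u²X(v) - v²X(u)`, `F = u +_F v`, `Fm = u -_F v`, the two sides
`2u²v²Δ²·(X(F)·Fm² + X(Fm)·F²)` and `F²Fm²·(Ỹ(u)²v⁶ + Ỹ(v)²u⁶ - (b₂u²v² + 4v²X(u) + 4u²X(v))·Δ²)`
are `p`-integral series (`isPadicInt_addXLHS/RHS`) whose values at `(t₁, t₂)` in the open unit
polydisc are the expected expressions in `X̂(tᵢ)`, `F̂(t₁, t₂)`, `F̂(t₁, î(t₂))`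
(`padicEval₂_addXLHS/RHS`, evaluation homomorphism of `PadicSeriesEvaluation.lean`).

## Sources

* C. Blakestad, D. Grant, J. Number Theory 249 (2023) (arXiv:1903.02480), §3 Lemma 10, Prop. 14.
* J. H. Silverman, *AEC* 2nd ed. (2009), III.2.3 (group law algorithm: `x(P+Q) = λ² + a₁λ - a₂ -
  x₁ - x₂`), IV.1–2, VII.2.2.

## Design notes

Stated for `V/ℚ_p` with `[V.IsIntegral ℤ_[p]]`. No definitions, no named facts; the two sides are
written out (the literals `2`, `4` are rewritten as `C 2`, `C 4` for evaluation).
-/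
noncomputable section

open scoped Classical
open PowerSeries Literature.NumberTheory.EllipticCurves

namespace WeierstrassCurve

/-! ### The addition formula at points -/

/-- **`x(P+Q) + x(P-Q)` for `x(P) ≠ x(Q)`**: with `Yᵢ = 2yᵢ + a₁xᵢ + a₃`,
`2(x₁ - x₂)²·(x(P+Q) + x(P-Q)) = Y₁² + Y₂² - (b₂ + 4x₁ + 4x₂)(x₁ - x₂)²` for Mathlib's
chord coordinates `x(P ± Q) = addX x₁ x₂ (slope …)` — pure algebra from
`x(P ± Q) = λ² + a₁λ - a₂ - x₁ - x₂`, `λ₊ = (y₁ - y₂)/(x₁ - x₂)`, `λ₋ = (y₁ + y₂ + a₁x₂ + a₃)/(x₁ - x₂)`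
(no use of the curve equation). [Silverman AEC III.2.3 (group law algorithm);
Blakestad–Grant 2023, Lemma 10] [folklore] -/
theorem two_mul_sq_mul_addX_add_addX {K : Type*} [Field K] [DecidableEq K] (W : WeierstrassCurve K)
    {x₁ x₂ : K} (y₁ y₂ : K) (hx : x₁ ≠ x₂) :
    2 * (x₁ - x₂) ^ 2 * (W.toAffine.addX x₁ x₂ (W.toAffine.slope x₁ x₂ y₁ y₂) +
        W.toAffine.addX x₁ x₂ (W.toAffine.slope x₁ x₂ y₁ (W.toAffine.negY x₂ y₂))) =
      (2 * y₁ + W.a₁ * x₁ + W.a₃) ^ 2 + (2 * y₂ + W.a₁ * x₂ + W.a₃) ^ 2 -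
        (W.b₂ + 4 * x₁ + 4 * x₂) * (x₁ - x₂) ^ 2 := by
  rw [Affine.slope_of_X_ne hx, Affine.slope_of_X_ne hx]
  have hx' : x₁ - x₂ ≠ 0 := sub_ne_zero.mpr hx
  simp only [Affine.addX, Affine.negY, b₂]
  field_simp
  ring

/-! ### Integrality and evaluation of the pieces -/

section Pieces

variable {p : ℕ} [Fact p.Prime] (V : WeierstrassCurve ℚ_[p]) [hV : V.IsIntegral ℤ_[p]]

/-- `‖2‖ ≤ 1`, `‖4‖ ≤ 1`, `‖b₂‖ ≤ 1` in `ℚ_p` (integral coefficients). [folklore] -/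
theorem norm_two_four_b₂_le_one : ‖(2 : ℚ_[p])‖ ≤ 1 ∧ ‖(4 : ℚ_[p])‖ ≤ 1 ∧ ‖V.b₂‖ ≤ 1 := by
  obtain ⟨ha₁, ha₂, -, -, -⟩ := V.norm_coeffs_le_one
  have h2 : ‖(2 : ℚ_[p])‖ ≤ 1 := by
    have := Padic.norm_int_le_one (p := p) 2; exact_mod_cast this
  have h4 : ‖(4 : ℚ_[p])‖ ≤ 1 := by
    have := Padic.norm_int_le_one (p := p) 4; exact_mod_cast this
  refine ⟨h2, h4, ?_⟩
  rw [b₂]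
  refine (Padic.nonarchimedean _ _).trans (max_le ?_ ?_)
  · rw [norm_pow]; exact pow_le_one₀ (norm_nonneg _) ha₁
  · rw [norm_mul]; exact mul_le_one₀ h4 (norm_nonneg _) ha₂

/-- `X(u +_F v)` is integral. [folklore] -/
theorem isPadicInt_formalXMulSq_subst_formalGroupLaw :
    IsPadicInt (V.formalXMulSq.subst V.formalGroupLaw) :=
  V.isPadicInt_formalXMulSq.powerSeries_subst V.isPadicInt_formalGroupLaw V.hasSubst_formalGroupLaw

/-- `X(u -_F v)` is integral. [folklore] -/
theorem isPadicInt_formalXMulSq_subst_formalGroupLawSub :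
    IsPadicInt (V.formalXMulSq.subst V.formalGroupLawSub) :=
  V.isPadicInt_formalXMulSq.powerSeries_subst V.isPadicInt_formalGroupLawSub
    (PowerSeries.HasSubst.of_constantCoeff_zero V.constantCoeff_formalGroupLawSub)

/-- `Ỹ(zᵢ) = (a₁zᵢ - 2)X(zᵢ) + a₃zᵢ³` is integral. [folklore] -/
theorem isPadicInt_formalYTilde_subst (i : Fin 2) :
    IsPadicInt ((MvPowerSeries.C V.a₁ * MvPowerSeries.X i - 2) *
        V.formalXMulSq.subst (MvPowerSeries.X i : MvPowerSeries (Fin 2) ℚ_[p]) +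
      MvPowerSeries.C V.a₃ * (MvPowerSeries.X i) ^ 3) := by
  obtain ⟨ha₁, -, ha₃, -, -⟩ := V.norm_coeffs_le_one
  have h2 : IsPadicInt (2 : MvPowerSeries (Fin 2) ℚ_[p]) := by
    rw [show (2 : MvPowerSeries (Fin 2) ℚ_[p]) = MvPowerSeries.C 2 from (map_ofNat _ 2).symm]
    exact IsPadicInt.C V.norm_two_four_b₂_le_one.1
  exact ((((IsPadicInt.C ha₁).mul (IsPadicInt.X i)).sub h2).mul
    (V.isPadicInt_formalXMulSq.powerSeries_subst (IsPadicInt.X i) (PowerSeries.HasSubst.X i))).add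
    ((IsPadicInt.C ha₃).mul ((IsPadicInt.X i).pow 3))

/-- `Δ = u²X(v) - v²X(u)` is integral. [folklore] -/
theorem isPadicInt_formalDelta :
    IsPadicInt ((MvPowerSeries.X 0 : MvPowerSeries (Fin 2) ℚ_[p]) ^ 2 *
        V.formalXMulSq.subst (MvPowerSeries.X 1 : MvPowerSeries (Fin 2) ℚ_[p]) -
      (MvPowerSeries.X 1 : MvPowerSeries (Fin 2) ℚ_[p]) ^ 2 *
        V.formalXMulSq.subst (MvPowerSeries.X 0 : MvPowerSeries (Fin 2) ℚ_[p])) :=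
  (((IsPadicInt.X 0).pow 2).mul (V.isPadicInt_formalXMulSq.powerSeries_subst (IsPadicInt.X 1)
    (PowerSeries.HasSubst.X 1))).sub (((IsPadicInt.X 1).pow 2).mul
    (V.isPadicInt_formalXMulSq.powerSeries_subst (IsPadicInt.X 0) (PowerSeries.HasSubst.X 0)))

variable {V} {t₁ t₂ : ℚ_[p]}

/-- **`(u -_F v)(t₁, t₂) = F̂(t₁, î(t₂))`.** [folklore] -/
theorem padicEval₂_formalGroupLawSub (h₁ : ‖t₁‖ < 1) (h₂ : ‖t₂‖ < 1) :
    padicEval₂ V.formalGroupLawSub t₁ t₂ =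
      padicEval₂ V.formalGroupLaw t₁ (padicEval V.formalNeg t₂) := by
  unfold formalGroupLawSub
  rw [padicEval₂_substPair V.isPadicInt_formalGroupLaw (IsPadicInt.X 0)
      (V.isPadicInt_formalNeg.powerSeries_subst (IsPadicInt.X 1) (PowerSeries.HasSubst.X 1))
      (MvPowerSeries.constantCoeff_X 0) (V.constantCoeff_formalNeg_subst_X 1) h₁ h₂,
    padicEval₂_X, padicEval₂_subst_X V.isPadicInt_formalNeg h₁ h₂]
  rfl

/-- `X(u +_F v)(t₁, t₂) = X̂(F̂(t₁, t₂))`. [folklore] -/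
theorem padicEval₂_formalXMulSq_subst_formalGroupLaw (h₁ : ‖t₁‖ < 1) (h₂ : ‖t₂‖ < 1) :
    padicEval₂ (V.formalXMulSq.subst V.formalGroupLaw) t₁ t₂ =
      padicEval V.formalXMulSq (padicEval₂ V.formalGroupLaw t₁ t₂) :=
  padicEval₂_subst V.isPadicInt_formalXMulSq V.isPadicInt_formalGroupLaw
    V.constantCoeff_formalGroupLaw h₁ h₂

/-- `X(u -_F v)(t₁, t₂) = X̂(F̂(t₁, î(t₂)))`. [folklore] -/
theorem padicEval₂_formalXMulSq_subst_formalGroupLawSub (h₁ : ‖t₁‖ < 1) (h₂ : ‖t₂‖ < 1) :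
    padicEval₂ (V.formalXMulSq.subst V.formalGroupLawSub) t₁ t₂ =
      padicEval V.formalXMulSq (padicEval₂ V.formalGroupLaw t₁ (padicEval V.formalNeg t₂)) := by
  rw [padicEval₂_subst V.isPadicInt_formalXMulSq V.isPadicInt_formalGroupLawSub
    V.constantCoeff_formalGroupLawSub h₁ h₂, padicEval₂_formalGroupLawSub h₁ h₂]

/-- `Ỹ(zᵢ)(t₁, t₂) = (a₁tᵢ - 2)X̂(tᵢ) + a₃tᵢ³`. [folklore] -/
theorem padicEval₂_formalYTilde_subst (h₁ : ‖t₁‖ < 1) (h₂ : ‖t₂‖ < 1) (i : Fin 2) :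
    padicEval₂ ((MvPowerSeries.C V.a₁ * MvPowerSeries.X i - 2) *
        V.formalXMulSq.subst (MvPowerSeries.X i : MvPowerSeries (Fin 2) ℚ_[p]) +
      MvPowerSeries.C V.a₃ * (MvPowerSeries.X i) ^ 3) t₁ t₂ =
      (V.a₁ * ![t₁, t₂] i - 2) * padicEval V.formalXMulSq (![t₁, t₂] i) + V.a₃ * (![t₁, t₂] i) ^ 3 := by
  obtain ⟨ha₁, -, ha₃, -, -⟩ := V.norm_coeffs_le_one
  rw [show (2 : MvPowerSeries (Fin 2) ℚ_[p]) = MvPowerSeries.C 2 from (map_ofNat _ 2).symm]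
  have h2 : IsPadicInt (MvPowerSeries.C 2 : MvPowerSeries (Fin 2) ℚ_[p]) :=
    IsPadicInt.C V.norm_two_four_b₂_le_one.1
  have hXi := V.isPadicInt_formalXMulSq.powerSeries_subst (IsPadicInt.X i) (PowerSeries.HasSubst.X i)
  have hA := ((IsPadicInt.C ha₁).mul (IsPadicInt.X i)).sub h2
  rw [padicEval₂_add (hA.mul hXi) ((IsPadicInt.C ha₃).mul ((IsPadicInt.X i).pow 3)) h₁ h₂,
    padicEval₂_mul hA hXi h₁ h₂, padicEval₂_sub ((IsPadicInt.C ha₁).mul (IsPadicInt.X i)) h2 h₁ h₂,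
    padicEval₂_mul (IsPadicInt.C ha₁) (IsPadicInt.X i) h₁ h₂,
    padicEval₂_mul (IsPadicInt.C ha₃) ((IsPadicInt.X i).pow 3) h₁ h₂,
    padicEval₂_pow (IsPadicInt.X i) h₁ h₂, padicEval₂_C, padicEval₂_C, padicEval₂_C, padicEval₂_X,
    padicEval₂_subst_X V.isPadicInt_formalXMulSq h₁ h₂]

/-- `Δ(t₁, t₂) = t₁²X̂(t₂) - t₂²X̂(t₁)`. [folklore] -/
theorem padicEval₂_formalDelta (h₁ : ‖t₁‖ < 1) (h₂ : ‖t₂‖ < 1) :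
    padicEval₂ ((MvPowerSeries.X 0 : MvPowerSeries (Fin 2) ℚ_[p]) ^ 2 *
        V.formalXMulSq.subst (MvPowerSeries.X 1 : MvPowerSeries (Fin 2) ℚ_[p]) -
      (MvPowerSeries.X 1 : MvPowerSeries (Fin 2) ℚ_[p]) ^ 2 *
        V.formalXMulSq.subst (MvPowerSeries.X 0 : MvPowerSeries (Fin 2) ℚ_[p])) t₁ t₂ =
      t₁ ^ 2 * padicEval V.formalXMulSq t₂ - t₂ ^ 2 * padicEval V.formalXMulSq t₁ := by
  have hX0 := V.isPadicInt_formalXMulSq.powerSeries_subst (IsPadicInt.X (0 : Fin 2))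
    (PowerSeries.HasSubst.X 0)
  have hX1 := V.isPadicInt_formalXMulSq.powerSeries_subst (IsPadicInt.X (1 : Fin 2))
    (PowerSeries.HasSubst.X 1)
  rw [padicEval₂_sub (((IsPadicInt.X 0).pow 2).mul hX1) (((IsPadicInt.X 1).pow 2).mul hX0) h₁ h₂,
    padicEval₂_mul ((IsPadicInt.X 0).pow 2) hX1 h₁ h₂, padicEval₂_mul ((IsPadicInt.X 1).pow 2) hX0 h₁ h₂,
    padicEval₂_pow (IsPadicInt.X 0) h₁ h₂, padicEval₂_pow (IsPadicInt.X 1) h₁ h₂, padicEval₂_X,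
    padicEval₂_X, padicEval₂_subst_X V.isPadicInt_formalXMulSq h₁ h₂,
    padicEval₂_subst_X V.isPadicInt_formalXMulSq h₁ h₂]
  rfl

end Pieces

/-! ### The two sides times `u·v·Δ`, evaluated -/

section Sides

variable {p : ℕ} [Fact p.Prime] (V : WeierstrassCurve ℚ_[p]) [hV : V.IsIntegral ℤ_[p]]

/-- The left side `2u²v²Δ²·(X(F)Fm² + X(Fm)F²)` is integral. [folklore] -/
theorem isPadicInt_addXLHS :
    IsPadicInt (2 * (MvPowerSeries.X 0 : MvPowerSeries (Fin 2) ℚ_[p]) ^ 2 *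
      (MvPowerSeries.X 1 : MvPowerSeries (Fin 2) ℚ_[p]) ^ 2 *
      ((MvPowerSeries.X 0 : MvPowerSeries (Fin 2) ℚ_[p]) ^ 2 *
          V.formalXMulSq.subst (MvPowerSeries.X 1 : MvPowerSeries (Fin 2) ℚ_[p]) -
        (MvPowerSeries.X 1 : MvPowerSeries (Fin 2) ℚ_[p]) ^ 2 *
          V.formalXMulSq.subst (MvPowerSeries.X 0 : MvPowerSeries (Fin 2) ℚ_[p])) ^ 2 *
      (V.formalXMulSq.subst V.formalGroupLaw * V.formalGroupLawSub ^ 2 +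
        V.formalXMulSq.subst V.formalGroupLawSub * V.formalGroupLaw ^ 2)) := by
  have h2 : IsPadicInt (2 : MvPowerSeries (Fin 2) ℚ_[p]) := by
    rw [show (2 : MvPowerSeries (Fin 2) ℚ_[p]) = MvPowerSeries.C 2 from (map_ofNat _ 2).symm]
    exact IsPadicInt.C V.norm_two_four_b₂_le_one.1
  exact (((h2.mul ((IsPadicInt.X 0).pow 2)).mul ((IsPadicInt.X 1).pow 2)).mul
    (V.isPadicInt_formalDelta.pow 2)).mul
    ((V.isPadicInt_formalXMulSq_subst_formalGroupLaw.mul (V.isPadicInt_formalGroupLawSub.pow 2)).add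
      (V.isPadicInt_formalXMulSq_subst_formalGroupLawSub.mul (V.isPadicInt_formalGroupLaw.pow 2)))

/-- The right side `F²Fm²·(Ỹ(u)²v⁶ + Ỹ(v)²u⁶ - (b₂u²v² + 4v²X(u) + 4u²X(v))Δ²)` is integral.
[folklore] -/
theorem isPadicInt_addXRHS :
    IsPadicInt (V.formalGroupLaw ^ 2 * V.formalGroupLawSub ^ 2 *
      (((MvPowerSeries.C V.a₁ * MvPowerSeries.X 0 - 2) *
            V.formalXMulSq.subst (MvPowerSeries.X 0 : MvPowerSeries (Fin 2) ℚ_[p]) +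
          MvPowerSeries.C V.a₃ * (MvPowerSeries.X 0) ^ 3) ^ 2 *
          (MvPowerSeries.X 1 : MvPowerSeries (Fin 2) ℚ_[p]) ^ 6 +
        ((MvPowerSeries.C V.a₁ * MvPowerSeries.X 1 - 2) *
            V.formalXMulSq.subst (MvPowerSeries.X 1 : MvPowerSeries (Fin 2) ℚ_[p]) +
          MvPowerSeries.C V.a₃ * (MvPowerSeries.X 1) ^ 3) ^ 2 *
          (MvPowerSeries.X 0 : MvPowerSeries (Fin 2) ℚ_[p]) ^ 6 -
        (MvPowerSeries.C V.b₂ * (MvPowerSeries.X 0 : MvPowerSeries (Fin 2) ℚ_[p]) ^ 2 *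
              (MvPowerSeries.X 1 : MvPowerSeries (Fin 2) ℚ_[p]) ^ 2 +
            4 * (MvPowerSeries.X 1 : MvPowerSeries (Fin 2) ℚ_[p]) ^ 2 *
              V.formalXMulSq.subst (MvPowerSeries.X 0 : MvPowerSeries (Fin 2) ℚ_[p]) +
          4 * (MvPowerSeries.X 0 : MvPowerSeries (Fin 2) ℚ_[p]) ^ 2 *
              V.formalXMulSq.subst (MvPowerSeries.X 1 : MvPowerSeries (Fin 2) ℚ_[p])) *
        ((MvPowerSeries.X 0 : MvPowerSeries (Fin 2) ℚ_[p]) ^ 2 *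
            V.formalXMulSq.subst (MvPowerSeries.X 1 : MvPowerSeries (Fin 2) ℚ_[p]) -
          (MvPowerSeries.X 1 : MvPowerSeries (Fin 2) ℚ_[p]) ^ 2 *
            V.formalXMulSq.subst (MvPowerSeries.X 0 : MvPowerSeries (Fin 2) ℚ_[p])) ^ 2)) := by
  have h4 : IsPadicInt (4 : MvPowerSeries (Fin 2) ℚ_[p]) := by
    rw [show (4 : MvPowerSeries (Fin 2) ℚ_[p]) = MvPowerSeries.C 4 from (map_ofNat _ 4).symm]
    exact IsPadicInt.C V.norm_two_four_b₂_le_one.2.1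
  have hb : IsPadicInt (MvPowerSeries.C V.b₂ : MvPowerSeries (Fin 2) ℚ_[p]) :=
    IsPadicInt.C V.norm_two_four_b₂_le_one.2.2
  have hX0 := V.isPadicInt_formalXMulSq.powerSeries_subst (IsPadicInt.X (0 : Fin 2))
    (PowerSeries.HasSubst.X 0)
  have hX1 := V.isPadicInt_formalXMulSq.powerSeries_subst (IsPadicInt.X (1 : Fin 2))
    (PowerSeries.HasSubst.X 1)
  exact ((V.isPadicInt_formalGroupLaw.pow 2).mul (V.isPadicInt_formalGroupLawSub.pow 2)).mul
    (((((V.isPadicInt_formalYTilde_subst 0).pow 2).mul ((IsPadicInt.X 1).pow 6)).add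
      (((V.isPadicInt_formalYTilde_subst 1).pow 2).mul ((IsPadicInt.X 0).pow 6))).sub
      (((((hb.mul ((IsPadicInt.X 0).pow 2)).mul ((IsPadicInt.X 1).pow 2)).add
        ((h4.mul ((IsPadicInt.X 1).pow 2)).mul hX0)).add ((h4.mul ((IsPadicInt.X 0).pow 2)).mul hX1)).mul
        (V.isPadicInt_formalDelta.pow 2)))

variable {V} {t₁ t₂ : ℚ_[p]}

/-- **Value of the left side.** [folklore] -/
theorem padicEval₂_addXLHS (h₁ : ‖t₁‖ < 1) (h₂ : ‖t₂‖ < 1) :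
    padicEval₂ (2 * (MvPowerSeries.X 0 : MvPowerSeries (Fin 2) ℚ_[p]) ^ 2 *
      (MvPowerSeries.X 1 : MvPowerSeries (Fin 2) ℚ_[p]) ^ 2 *
      ((MvPowerSeries.X 0 : MvPowerSeries (Fin 2) ℚ_[p]) ^ 2 *
          V.formalXMulSq.subst (MvPowerSeries.X 1 : MvPowerSeries (Fin 2) ℚ_[p]) -
        (MvPowerSeries.X 1 : MvPowerSeries (Fin 2) ℚ_[p]) ^ 2 *
          V.formalXMulSq.subst (MvPowerSeries.X 0 : MvPowerSeries (Fin 2) ℚ_[p])) ^ 2 *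
      (V.formalXMulSq.subst V.formalGroupLaw * V.formalGroupLawSub ^ 2 +
        V.formalXMulSq.subst V.formalGroupLawSub * V.formalGroupLaw ^ 2)) t₁ t₂ =
      2 * t₁ ^ 2 * t₂ ^ 2 *
        (t₁ ^ 2 * padicEval V.formalXMulSq t₂ - t₂ ^ 2 * padicEval V.formalXMulSq t₁) ^ 2 *
        (padicEval V.formalXMulSq (padicEval₂ V.formalGroupLaw t₁ t₂) *
            padicEval₂ V.formalGroupLaw t₁ (padicEval V.formalNeg t₂) ^ 2 +
          padicEval V.formalXMulSq (padicEval₂ V.formalGroupLaw t₁ (padicEval V.formalNeg t₂)) *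
            padicEval₂ V.formalGroupLaw t₁ t₂ ^ 2) := by
  rw [show (2 : MvPowerSeries (Fin 2) ℚ_[p]) = MvPowerSeries.C 2 from (map_ofNat _ 2).symm]
  have h2 : IsPadicInt (MvPowerSeries.C 2 : MvPowerSeries (Fin 2) ℚ_[p]) :=
    IsPadicInt.C V.norm_two_four_b₂_le_one.1
  have hΔ := V.isPadicInt_formalDelta
  have hXF := V.isPadicInt_formalXMulSq_subst_formalGroupLaw
  have hXFm := V.isPadicInt_formalXMulSq_subst_formalGroupLawSub
  have hF := V.isPadicInt_formalGroupLaw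
  have hFm := V.isPadicInt_formalGroupLawSub
  have hX0 : IsPadicInt ((MvPowerSeries.X 0 : MvPowerSeries (Fin 2) ℚ_[p]) ^ 2) := (IsPadicInt.X 0).pow 2
  have hX1 : IsPadicInt ((MvPowerSeries.X 1 : MvPowerSeries (Fin 2) ℚ_[p]) ^ 2) := (IsPadicInt.X 1).pow 2
  rw [padicEval₂_mul (((h2.mul hX0).mul hX1).mul (hΔ.pow 2))
      ((hXF.mul (hFm.pow 2)).add (hXFm.mul (hF.pow 2))) h₁ h₂,
    padicEval₂_mul ((h2.mul hX0).mul hX1) (hΔ.pow 2) h₁ h₂, padicEval₂_mul (h2.mul hX0) hX1 h₁ h₂,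
    padicEval₂_mul h2 hX0 h₁ h₂, padicEval₂_add (hXF.mul (hFm.pow 2)) (hXFm.mul (hF.pow 2)) h₁ h₂,
    padicEval₂_mul hXF (hFm.pow 2) h₁ h₂, padicEval₂_mul hXFm (hF.pow 2) h₁ h₂,
    padicEval₂_pow hFm h₁ h₂, padicEval₂_pow hF h₁ h₂, padicEval₂_pow hΔ h₁ h₂,
    padicEval₂_pow (IsPadicInt.X 0) h₁ h₂, padicEval₂_pow (IsPadicInt.X 1) h₁ h₂, padicEval₂_C,
    padicEval₂_X, padicEval₂_X, padicEval₂_formalDelta h₁ h₂,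
    padicEval₂_formalXMulSq_subst_formalGroupLaw h₁ h₂,
    padicEval₂_formalXMulSq_subst_formalGroupLawSub h₁ h₂, padicEval₂_formalGroupLawSub h₁ h₂]
  rfl

/-- **Value of the right side.** [folklore] -/
theorem padicEval₂_addXRHS (h₁ : ‖t₁‖ < 1) (h₂ : ‖t₂‖ < 1) :
    padicEval₂ (V.formalGroupLaw ^ 2 * V.formalGroupLawSub ^ 2 *
      (((MvPowerSeries.C V.a₁ * MvPowerSeries.X 0 - 2) *
            V.formalXMulSq.subst (MvPowerSeries.X 0 : MvPowerSeries (Fin 2) ℚ_[p]) +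
          MvPowerSeries.C V.a₃ * (MvPowerSeries.X 0) ^ 3) ^ 2 *
          (MvPowerSeries.X 1 : MvPowerSeries (Fin 2) ℚ_[p]) ^ 6 +
        ((MvPowerSeries.C V.a₁ * MvPowerSeries.X 1 - 2) *
            V.formalXMulSq.subst (MvPowerSeries.X 1 : MvPowerSeries (Fin 2) ℚ_[p]) +
          MvPowerSeries.C V.a₃ * (MvPowerSeries.X 1) ^ 3) ^ 2 *
          (MvPowerSeries.X 0 : MvPowerSeries (Fin 2) ℚ_[p]) ^ 6 -
        (MvPowerSeries.C V.b₂ * (MvPowerSeries.X 0 : MvPowerSeries (Fin 2) ℚ_[p]) ^ 2 *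
              (MvPowerSeries.X 1 : MvPowerSeries (Fin 2) ℚ_[p]) ^ 2 +
            4 * (MvPowerSeries.X 1 : MvPowerSeries (Fin 2) ℚ_[p]) ^ 2 *
              V.formalXMulSq.subst (MvPowerSeries.X 0 : MvPowerSeries (Fin 2) ℚ_[p]) +
          4 * (MvPowerSeries.X 0 : MvPowerSeries (Fin 2) ℚ_[p]) ^ 2 *
              V.formalXMulSq.subst (MvPowerSeries.X 1 : MvPowerSeries (Fin 2) ℚ_[p])) *
        ((MvPowerSeries.X 0 : MvPowerSeries (Fin 2) ℚ_[p]) ^ 2 *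
            V.formalXMulSq.subst (MvPowerSeries.X 1 : MvPowerSeries (Fin 2) ℚ_[p]) -
          (MvPowerSeries.X 1 : MvPowerSeries (Fin 2) ℚ_[p]) ^ 2 *
            V.formalXMulSq.subst (MvPowerSeries.X 0 : MvPowerSeries (Fin 2) ℚ_[p])) ^ 2)) t₁ t₂ =
      padicEval₂ V.formalGroupLaw t₁ t₂ ^ 2 *
        padicEval₂ V.formalGroupLaw t₁ (padicEval V.formalNeg t₂) ^ 2 *
        (((V.a₁ * t₁ - 2) * padicEval V.formalXMulSq t₁ + V.a₃ * t₁ ^ 3) ^ 2 * t₂ ^ 6 +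
          ((V.a₁ * t₂ - 2) * padicEval V.formalXMulSq t₂ + V.a₃ * t₂ ^ 3) ^ 2 * t₁ ^ 6 -
          (V.b₂ * t₁ ^ 2 * t₂ ^ 2 + 4 * t₂ ^ 2 * padicEval V.formalXMulSq t₁ +
              4 * t₁ ^ 2 * padicEval V.formalXMulSq t₂) *
            (t₁ ^ 2 * padicEval V.formalXMulSq t₂ - t₂ ^ 2 * padicEval V.formalXMulSq t₁) ^ 2) := by
  have hYt := padicEval₂_formalYTilde_subst (V := V) h₁ h₂
  rw [show (4 : MvPowerSeries (Fin 2) ℚ_[p]) = MvPowerSeries.C 4 from (map_ofNat _ 4).symm]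
  have h4 : IsPadicInt (MvPowerSeries.C 4 : MvPowerSeries (Fin 2) ℚ_[p]) :=
    IsPadicInt.C V.norm_two_four_b₂_le_one.2.1
  have hb : IsPadicInt (MvPowerSeries.C V.b₂ : MvPowerSeries (Fin 2) ℚ_[p]) :=
    IsPadicInt.C V.norm_two_four_b₂_le_one.2.2
  have hX0 := V.isPadicInt_formalXMulSq.powerSeries_subst (IsPadicInt.X (0 : Fin 2))
    (PowerSeries.HasSubst.X 0)
  have hX1 := V.isPadicInt_formalXMulSq.powerSeries_subst (IsPadicInt.X (1 : Fin 2))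
    (PowerSeries.HasSubst.X 1)
  have hΔ := V.isPadicInt_formalDelta
  have hF := V.isPadicInt_formalGroupLaw
  have hFm := V.isPadicInt_formalGroupLawSub
  have hY0 := V.isPadicInt_formalYTilde_subst 0
  have hY1 := V.isPadicInt_formalYTilde_subst 1
  have hu2 : IsPadicInt ((MvPowerSeries.X 0 : MvPowerSeries (Fin 2) ℚ_[p]) ^ 2) := (IsPadicInt.X 0).pow 2
  have hv2 : IsPadicInt ((MvPowerSeries.X 1 : MvPowerSeries (Fin 2) ℚ_[p]) ^ 2) := (IsPadicInt.X 1).pow 2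
  have hu6 : IsPadicInt ((MvPowerSeries.X 0 : MvPowerSeries (Fin 2) ℚ_[p]) ^ 6) := (IsPadicInt.X 0).pow 6
  have hv6 : IsPadicInt ((MvPowerSeries.X 1 : MvPowerSeries (Fin 2) ℚ_[p]) ^ 6) := (IsPadicInt.X 1).pow 6
  have hA := ((hY0.pow 2).mul hv6).add ((hY1.pow 2).mul hu6)
  have hB := (((hb.mul hu2).mul hv2).add ((h4.mul hv2).mul hX0)).add ((h4.mul hu2).mul hX1)
  rw [padicEval₂_mul ((hF.pow 2).mul (hFm.pow 2)) (hA.sub (hB.mul (hΔ.pow 2))) h₁ h₂,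
    padicEval₂_mul (hF.pow 2) (hFm.pow 2) h₁ h₂, padicEval₂_pow hF h₁ h₂, padicEval₂_pow hFm h₁ h₂,
    padicEval₂_sub hA (hB.mul (hΔ.pow 2)) h₁ h₂,
    padicEval₂_add ((hY0.pow 2).mul hv6) ((hY1.pow 2).mul hu6) h₁ h₂,
    padicEval₂_mul (hY0.pow 2) hv6 h₁ h₂, padicEval₂_mul (hY1.pow 2) hu6 h₁ h₂,
    padicEval₂_pow hY0 h₁ h₂, padicEval₂_pow hY1 h₁ h₂, hYt 0, hYt 1,
    padicEval₂_mul hB (hΔ.pow 2) h₁ h₂, padicEval₂_pow hΔ h₁ h₂, padicEval₂_formalDelta h₁ h₂,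
    padicEval₂_add (((hb.mul hu2).mul hv2).add ((h4.mul hv2).mul hX0)) ((h4.mul hu2).mul hX1) h₁ h₂,
    padicEval₂_add ((hb.mul hu2).mul hv2) ((h4.mul hv2).mul hX0) h₁ h₂,
    padicEval₂_mul (hb.mul hu2) hv2 h₁ h₂, padicEval₂_mul hb hu2 h₁ h₂,
    padicEval₂_mul (h4.mul hv2) hX0 h₁ h₂, padicEval₂_mul h4 hv2 h₁ h₂,
    padicEval₂_mul (h4.mul hu2) hX1 h₁ h₂, padicEval₂_mul h4 hu2 h₁ h₂,
    padicEval₂_pow (IsPadicInt.X 0) h₁ h₂ 2, padicEval₂_pow (IsPadicInt.X 1) h₁ h₂ 2,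
    padicEval₂_pow (IsPadicInt.X 0) h₁ h₂ 6, padicEval₂_pow (IsPadicInt.X 1) h₁ h₂ 6,
    padicEval₂_subst_X V.isPadicInt_formalXMulSq h₁ h₂ 0,
    padicEval₂_subst_X V.isPadicInt_formalXMulSq h₁ h₂ 1, padicEval₂_formalGroupLawSub h₁ h₂]
  simp only [padicEval₂_C, padicEval₂_X, Matrix.cons_val_zero, Matrix.cons_val_one]

end Sides

end WeierstrassCurve
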